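import Mathlib
import Summits.AtomisticToContinuum.FouriersLaw.Statement
import Summits.AtomisticToContinuum.FouriersLaw.Theses.ContactStieltjesMeasure
import Summits.AtomisticToContinuum.FouriersLaw.Theses.BoundaryEscapeDeficit
import Summits.AtomisticToContinuum.FouriersLaw.Theses.OddSectorIrreversibility
import Summits.AtomisticToContinuum.FouriersLaw.Theorems.OddSectorIrreversibilityBoundedResponseConvergesEscapeDeficitForm
import Summits.AtomisticToContinuum.FouriersLaw.Theorems.EmbeddedDrudeMourreNessUnique
import Summits.AtomisticToContinuum.FouriersLaw.Theorems.ContactStieltjesMeasureContactMeasureLimitStieltjesContinuity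
import Literature.MathematicalPhysics.KineticTheory.LangevinChainNESSHolds

/-!
# Crux `ContactMeasureLimit` closed modulo items 12238 ∧ 10924
# (composition of line `IdeatorOneSketch` = line `escape-import` with its analysis stub PROVED)

Crux `ContactStieltjesMeasure.ContactMeasureLimit` (stmt-AtomisticToContinuum-15250) (M): for every family
`Φ_N` of contact distribution functions REPRESENTING the two-terminal response of `pinnedChain ω₂ lam β ·` at `T`
and every friction `γ`, the scaled functions `N·Φ_N` converge at the continuity points `t > 0` of a monotone `M`.

* `scaledTransforms_tendsto_of_items` — the PHYSICAL step from the two existing items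
  `BoundaryEscapeDeficit.EscapeNonOscillation` (stmt-12238: `N ↦ (N−1)·γ·E_N` has a limit in `EReal`) and
  `OddSectorIrreversibility.BoundedResponse` (stmt-10924: clause-(ii) response coefficients bounded in `N`):
  along the canonical steady-state family (existence `pinnedChain_exists_isSteadyState`, weak-NESS uniqueness
  `Theorems.nessUnique_proof`) the response coefficient `D_N = (N−1)γ∫Φ_N k_γ` equals the escape deficit
  `e_N` (`Theorems.responseCoeff_eq_escapeDeficit`), is bounded and has an `EReal` limit, hence a real one, so the
  scaled contact transforms `N·∫₀^∞ Φ_N k_γ = D_N·N/((N−1)γ)` converge for every `γ > 0` (strategist b1's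
  `escape-import` glue);
* `tendsto_scaled_of_transforms` — bookkeeping through the rescaled family `N·Φ_N` truncated below `N = 2`;
* `contactMeasureLimit_of_items : EscapeNonOscillation → BoundedResponse → ContactMeasureLimit` — with the
  analysis child `stieltjesContinuity` now a THEOREM of the tree, (M) rests on items 12238 and 10924 BY NAME and
  on nothing else (conditional result; the crux's `blocked-on`).
-/

noncomputable section

namespace Summit.AtomisticToContinuum.FouriersLaw.Theorems.ContactMeasureLimit

open MeasureTheory Filter Set Topology
open Literature.MathematicalPhysics.KineticTheory.HeatConduction
open Summit.AtomisticToContinuum.FouriersLaw.Theses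

/-- **Sequence lemma.** A real sequence bounded in absolute value whose `EReal` image converges, converges in
`ℝ`. [folklore] -/
theorem exists_tendsto_of_ereal_tendsto_of_abs_le (D : ℕ → ℝ) {ℓ : EReal}
    (hℓ : Tendsto (fun N : ℕ => ((D N : ℝ) : EReal)) atTop (𝓝 ℓ))
    {B : ℝ} (hB : ∀ N, |D N| ≤ B) : ∃ L : ℝ, Tendsto D atTop (𝓝 L) := by
  have hℓ_le : ℓ ≤ ((B : ℝ) : EReal) :=
    le_of_tendsto' hℓ fun N => EReal.coe_le_coe_iff.2 ((le_abs_self _).trans (hB N))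
  have hℓ_ge : ((-B : ℝ) : EReal) ≤ ℓ :=
    ge_of_tendsto' hℓ fun N => EReal.coe_le_coe_iff.2 (abs_le.1 (hB N)).1
  have hℓ_top : ℓ ≠ ⊤ := ne_top_of_le_ne_top (EReal.coe_ne_top _) hℓ_le
  have hℓ_bot : ℓ ≠ ⊥ := ne_bot_of_le_ne_bot (EReal.coe_ne_bot _) hℓ_ge
  refine ⟨ℓ.toReal, ?_⟩
  have h : Tendsto (fun N : ℕ => ((D N : ℝ) : EReal)) atTop (𝓝 ((ℓ.toReal : ℝ) : EReal)) := by
    rwa [EReal.coe_toReal hℓ_top hℓ_bot]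
  exact EReal.tendsto_coe.1 h

/-- **The physical step, from the two items.** Given `EscapeNonOscillation` (12238) and `BoundedResponse` (10924):
for `pinnedChain ω₂ lam β ·` (all `> 0`), `T > 0`, every representing family `Φ` and every friction `γ > 0`, the
scaled contact transforms `N·∫_(t>0) Φ_N(t)·2t/(γ²+t²)² dt` converge. Along the canonical steady-state family the
response coefficient `D_N = (N−1)γ∫Φ_N k_γ` (`N ≥ 2`) equals `e_N = (N−1)γE_N` (`responseCoeff_eq_escapeDeficit`),
is bounded (10924) and has an `EReal` limit (12238), hence a real one; `N∫Φ_N k_γ = D_N · N/((N−1)γ)`. -/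
theorem scaledTransforms_tendsto_of_items
    (hE : BoundaryEscapeDeficit.EscapeNonOscillation) (hB : OddSectorIrreversibility.BoundedResponse)
    {ω₂ lam β : ℝ} (hω : 0 < ω₂) (hl : 0 < lam) (hβ : 0 < β) {T : ℝ} (hT : 0 < T)
    (Φ : ℕ → ℝ → ℝ)
    (hΦ : ∀ N : ℕ, 2 ≤ N → Monotone (Φ N) ∧ (∀ s : ℝ, s ≤ 0 → Φ N s = 0) ∧ (∃ m : ℝ, ∀ s : ℝ, Φ N s ≤ m) ∧
      ∀ γ : ℝ, 0 < γ →
        (∀ (N' : ℕ) (T_L T_R : ℝ), 0 < T_L → 0 < T_R →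
          ∀ μ ν : MeasureTheory.Measure (PhaseSpace N'),
            (pinnedChain ω₂ lam β γ).IsSteadyState N' T_L T_R μ →
            (pinnedChain ω₂ lam β γ).IsSteadyState N' T_L T_R ν → μ = ν) →
        ∀ μ : (N' : ℕ) → ℝ → ℝ → MeasureTheory.Measure (PhaseSpace N'),
          (∀ (N' : ℕ) (T_L T_R : ℝ), 0 < T_L → 0 < T_R →
            (pinnedChain ω₂ lam β γ).IsSteadyState N' T_L T_R (μ N' T_L T_R)) →
          Filter.Tendsto (fun δ : ℝ =>
            (pinnedChain ω₂ lam β γ).totalCurrent (μ N (T + δ / 2) (T - δ / 2)) / δ)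
            (nhdsWithin 0 {(0 : ℝ)}ᶜ)
            (nhds (((N : ℝ) - 1) * γ * ∫ t in Set.Ioi (0 : ℝ), Φ N t * (2 * t / (γ ^ 2 + t ^ 2) ^ 2)))) :
    ∀ γ : ℝ, 0 < γ → ∃ L : ℝ,
      Tendsto (fun N : ℕ => (N : ℝ) * ∫ t in Set.Ioi (0 : ℝ), Φ N t * (2 * t / (γ ^ 2 + t ^ 2) ^ 2))
        atTop (𝓝 L) := by
  intro γ hγ
  have hU : ∀ (N : ℕ) (T_L T_R : ℝ), 0 < T_L → 0 < T_R → ∀ μ ν : Measure (PhaseSpace N),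
      (pinnedChain ω₂ lam β γ).IsSteadyState N T_L T_R μ →
        (pinnedChain ω₂ lam β γ).IsSteadyState N T_L T_R ν → μ = ν :=
    Summit.AtomisticToContinuum.FouriersLaw.Theorems.nessUnique_proof ω₂ lam β γ hω hl hβ hγ
  classical
  -- the canonical steady-state family (existence is the landed CEHR theorem; any family would do by uniqueness)
  set μc : (N : ℕ) → ℝ → ℝ → Measure (PhaseSpace N) := fun N T_L T_R =>
    if h : 0 < T_L ∧ 0 < T_R then
      Classical.choose (pinnedChain_exists_isSteadyState hω hl hβ hγ N h.1 h.2) else 0 with hμc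
  have hμc' : ∀ (N : ℕ) (T_L T_R : ℝ), 0 < T_L → 0 < T_R →
      (pinnedChain ω₂ lam β γ).IsSteadyState N T_L T_R (μc N T_L T_R) := by
    intro N T_L T_R hL hR
    have h : 0 < T_L ∧ 0 < T_R := ⟨hL, hR⟩
    simp only [hμc, dif_pos h]
    exact Classical.choose_spec (pinnedChain_exists_isSteadyState hω hl hβ hγ N h.1 h.2)
  -- the response sequence along `μc`: `(N-1)γ∫Φ_N k_γ` for `N ≥ 2`, `0` for the bondless chains `N ≤ 1`
  set I : ℕ → ℝ := fun N => ∫ t in Set.Ioi (0 : ℝ), Φ N t * (2 * t / (γ ^ 2 + t ^ 2) ^ 2) with hI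
  set D : ℕ → ℝ := fun N => if 2 ≤ N then ((N : ℝ) - 1) * γ * I N else 0 with hDdef
  have hD2 : ∀ N : ℕ, 2 ≤ N → D N = ((N : ℝ) - 1) * γ * I N := fun N hN => by
    simp only [hDdef, if_pos hN]
  have hresp : ∀ N : ℕ, Tendsto (fun δ : ℝ =>
      (pinnedChain ω₂ lam β γ).totalCurrent (μc N (T + δ / 2) (T - δ / 2)) / δ) (𝓝[≠] 0) (𝓝 (D N)) := by
    intro N
    by_cases hN : 2 ≤ N
    · rw [hD2 N hN]
      exact (hΦ N hN).2.2.2 γ hγ hU μc hμc'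
    · have hD0 : D N = 0 := by simp only [hDdef, if_neg hN]
      rw [hD0]
      have hj : ∀ (i : Fin N) (x : PhaseSpace N), (pinnedChain ω₂ lam β γ).bondCurrent N i x = 0 :=
        fun i x => by
          unfold OscillatorChain.bondCurrent
          refine Finset.sum_eq_zero fun j _ => ?_
          have hji : ¬ (j.val = i.val + 1) := by have := j.isLt; omega
          rw [if_neg hji]
      have e : (fun δ : ℝ =>
          (pinnedChain ω₂ lam β γ).totalCurrent (μc N (T + δ / 2) (T - δ / 2)) / δ) = fun _ => 0 := by
        funext δ
        have : (pinnedChain ω₂ lam β γ).totalCurrent (μc N (T + δ / 2) (T - δ / 2)) = 0 := by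
          unfold OscillatorChain.totalCurrent
          exact Finset.sum_eq_zero fun i _ => by simp only [hj, MeasureTheory.integral_zero]
        rw [this, zero_div]
      rw [e]
      exact tendsto_const_nhds
  -- item 10924: `|D_N|` bounded
  obtain ⟨Bd, hBd⟩ := hB ω₂ lam β γ hω hl hβ hγ hU μc hμc' T hT D hresp
  have hBd' : ∀ N : ℕ, |D N| ≤ Bd := fun N => hBd ⟨N, rfl⟩
  -- item 12238: `e_N` has an `EReal` limit; by the response identity `D_N = e_N` for `N ≥ 2`
  have hE' := hE ω₂ lam β γ hω hl hβ hγ T hT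
  dsimp only at hE'
  obtain ⟨ℓ, hℓ⟩ := hE'
  have hDe : ∀ N : ℕ, 2 ≤ N → D N = ((N : ℝ) - 1) * γ * (1 - γ / T ^ 2 * ∫ u in Set.Ioi (0 : ℝ),
      if h : 0 < N then ∫ z, ((z.2 ⟨0, h⟩) ^ 2 - T) * (∫ y, ((y.2 ⟨0, h⟩) ^ 2 - T)
        ∂((pinnedChain ω₂ lam β γ).transitionKernel N T T u.toNNReal z))
        ∂((pinnedChain ω₂ lam β γ).gibbsMeasure N T) else 0) := by
    intro N hN
    have hN0 : 0 < N := lt_of_lt_of_le Nat.two_pos hN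
    rw [Summit.AtomisticToContinuum.FouriersLaw.Theorems.responseCoeff_eq_escapeDeficit
      hω hl hβ hγ hU μc hμc' hT hN0 (hresp N)]
    simp only [dif_pos hN0]
  have hℓD : Tendsto (fun N : ℕ => ((D N : ℝ) : EReal)) atTop (𝓝 ℓ) := by
    refine hℓ.congr' ?_
    filter_upwards [eventually_ge_atTop 2] with N hN
    rw [hDe N hN]
  obtain ⟨Lr, hLr⟩ := exists_tendsto_of_ereal_tendsto_of_abs_le D hℓD hBd'
  -- `N·∫Φ_N k_γ = D_N · (N / ((N-1)·γ))` for `N ≥ 2`, and `N/(N-1) → 1`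
  refine ⟨Lr * (1 * γ⁻¹), ?_⟩
  have hfrac : Tendsto (fun N : ℕ => (N : ℝ) / ((N : ℝ) + (-1 : ℝ))) atTop (𝓝 1) :=
    tendsto_natCast_div_add_atTop (-1 : ℝ)
  have h2 : Tendsto (fun N : ℕ => D N * ((N : ℝ) / ((N : ℝ) + (-1 : ℝ)) * γ⁻¹)) atTop
      (𝓝 (Lr * (1 * γ⁻¹))) :=
    hLr.mul (hfrac.mul tendsto_const_nhds)
  refine h2.congr' ?_
  filter_upwards [eventually_ge_atTop 2] with N hN
  rw [hD2 N hN]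
  have hN1 : (N : ℝ) + (-1 : ℝ) ≠ 0 := by
    have : (2 : ℝ) ≤ (N : ℝ) := by exact_mod_cast hN
    linarith
  have hγ0 : γ ≠ 0 := hγ.ne'
  have alg : ∀ J : ℝ,
      ((N : ℝ) - 1) * γ * J * ((N : ℝ) / ((N : ℝ) + (-1 : ℝ)) * γ⁻¹) = (N : ℝ) * J := by
    intro J
    field_simp
    ring
  exact alg _

/-- GLUE: the continuity theorem (hypothesis `hS`) turns per-friction convergence of the scaled transforms
`N·∫ Φ_N k_γ` of a family that is monotone / vanishing on `(-∞,0]` / bounded from `N = 2` on into convergence of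
`N·Φ_N(t)` at the continuity points of a monotone `M` (bookkeeping through the rescaled family truncated to `0`
below `N = 2`). -/
theorem tendsto_scaled_of_transforms
    (hS : ∀ F : ℕ → ℝ → ℝ,
      (∀ N : ℕ, Monotone (F N) ∧ (∀ s : ℝ, s ≤ 0 → F N s = 0) ∧ (∃ m : ℝ, ∀ s : ℝ, F N s ≤ m)) →
      (∀ γ : ℝ, 0 < γ → ∃ L : ℝ,
        Filter.Tendsto (fun N : ℕ => ∫ t in Set.Ioi (0 : ℝ), F N t * (2 * t / (γ ^ 2 + t ^ 2) ^ 2))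
          Filter.atTop (nhds L)) →
      ∃ M : ℝ → ℝ, Monotone M ∧ ∀ t : ℝ, 0 < t → ContinuousAt M t →
        Filter.Tendsto (fun N : ℕ => F N t) Filter.atTop (nhds (M t)))
    (Φ : ℕ → ℝ → ℝ)
    (hΦ : ∀ N : ℕ, 2 ≤ N → Monotone (Φ N) ∧ (∀ s : ℝ, s ≤ 0 → Φ N s = 0) ∧ (∃ m : ℝ, ∀ s : ℝ, Φ N s ≤ m))
    (hC : ∀ γ : ℝ, 0 < γ → ∃ L : ℝ,
      Filter.Tendsto (fun N : ℕ => (N : ℝ) * ∫ t in Set.Ioi (0 : ℝ), Φ N t * (2 * t / (γ ^ 2 + t ^ 2) ^ 2))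
        Filter.atTop (nhds L)) :
    ∃ M : ℝ → ℝ, Monotone M ∧ ∀ t : ℝ, 0 < t → ContinuousAt M t →
      Filter.Tendsto (fun N : ℕ => (N : ℝ) * Φ N t) Filter.atTop (nhds (M t)) := by
  let S : ℕ → ℝ → ℝ := fun N t => if 2 ≤ N then (N : ℝ) * Φ N t else 0
  have hS_le : ∀ {N : ℕ}, 2 ≤ N → ∀ t, S N t = (N : ℝ) * Φ N t := fun hN t => if_pos hN
  have hS_not : ∀ {N : ℕ}, ¬ 2 ≤ N → ∀ t, S N t = 0 := fun hN t => if_neg hN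
  have h1 : ∀ N : ℕ, Monotone (S N) ∧ (∀ s : ℝ, s ≤ 0 → S N s = 0) ∧
      (∃ m : ℝ, ∀ s : ℝ, S N s ≤ m) := by
    intro N
    by_cases hN : 2 ≤ N
    · obtain ⟨hmono, hzero, ⟨m, hm⟩⟩ := hΦ N hN
      have hN0 : (0 : ℝ) ≤ (N : ℝ) := Nat.cast_nonneg N
      refine ⟨fun a b hab => ?_, fun s hs => ?_, ⟨(N : ℝ) * m, fun s => ?_⟩⟩
      · rw [hS_le hN, hS_le hN]
        exact mul_le_mul_of_nonneg_left (hmono hab) hN0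
      · rw [hS_le hN, hzero s hs, mul_zero]
      · rw [hS_le hN]
        exact mul_le_mul_of_nonneg_left (hm s) hN0
    · refine ⟨fun a b _ => ?_, fun s _ => hS_not hN s, ⟨0, fun s => ?_⟩⟩
      · rw [hS_not hN, hS_not hN]
      · rw [hS_not hN]
  have h2 : ∀ γ : ℝ, 0 < γ → ∃ L : ℝ, Filter.Tendsto
      (fun N : ℕ => ∫ t in Set.Ioi (0 : ℝ), S N t * (2 * t / (γ ^ 2 + t ^ 2) ^ 2))
      Filter.atTop (nhds L) := by
    intro γ hγ
    obtain ⟨L, hL⟩ := hC γ hγ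
    refine ⟨L, hL.congr' ?_⟩
    filter_upwards [Filter.eventually_ge_atTop 2] with N hN
    have hfun : (fun t : ℝ => S N t * (2 * t / (γ ^ 2 + t ^ 2) ^ 2)) =
        fun t : ℝ => (N : ℝ) * (Φ N t * (2 * t / (γ ^ 2 + t ^ 2) ^ 2)) := by
      funext t
      rw [hS_le hN, mul_assoc]
    rw [hfun, MeasureTheory.integral_const_mul]
  obtain ⟨M, hMmono, hM⟩ := hS S h1 h2
  refine ⟨M, hMmono, fun t ht hct => ?_⟩
  refine (hM t ht hct).congr' ?_
  filter_upwards [Filter.eventually_ge_atTop 2] with N hN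
  exact hS_le hN t

/-- **(M) from the two physics items** — crux `ContactMeasureLimit` (stmt-AtomisticToContinuum-15250) closed
MODULO items stmt-12238 `EscapeNonOscillation` and stmt-10924 `BoundedResponse` (taken by name as hypotheses;
a conditional result): the analysis child `stieltjesContinuity` is a theorem. This is the glue of the
route-level split `ContactMeasureLimit ⇐ StieltjesContinuity ∧ EscapeNonOscillation ∧ BoundedResponse`. -/
theorem contactMeasureLimit_of_items :
    Summit.AtomisticToContinuum.FouriersLaw.Theses.BoundaryEscapeDeficit.EscapeNonOscillation →
      Summit.AtomisticToContinuum.FouriersLaw.Theses.OddSectorIrreversibility.BoundedResponse →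
      Summit.AtomisticToContinuum.FouriersLaw.Theses.ContactStieltjesMeasure.ContactMeasureLimit := by
  intro hE hB ω₂ lam β hω hl hβ T hT Φ hΦ
  exact tendsto_scaled_of_transforms stieltjesContinuity Φ
    (fun N hN => ⟨(hΦ N hN).1, (hΦ N hN).2.1, (hΦ N hN).2.2.1⟩)
    (scaledTransforms_tendsto_of_items hE hB hω hl hβ hT Φ hΦ)

end Summit.AtomisticToContinuum.FouriersLaw.Theorems.ContactMeasureLimit

end
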